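import Mathlib
import HarnessLib
import Summits.NavierStokesRegularity.NavierStokesRegularity.Theorems.PoloidalWindowDoorPoloidalWindowRigidityZShockAutonomyPropagation
import Summits.NavierStokesRegularity.NavierStokesRegularity.Theorems.PoloidalWindowDoorPoloidalWindowRigidityK2OfLrcSlope
import Summits.NavierStokesRegularity.NavierStokesRegularity.Theorems.PoloidalWindowDoorPoloidalWindowRigidityZShockThInstantSlope

/-!
# Crux K2 `PoloidalWindowRigidity` (stmt-NavierStokesRegularity-19708), line `z_shock` — L0 IN SPACE–TIME: the LOCAL autonomy clause of
# the deciding stub at ONE window point globalises to the WHOLE BACKWARD SLAB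

`--supports stmt-NavierStokesRegularity-19708 --as helper` (leafhand-ns-poloidalwindowdoor-3 g12, cell decomp-ns, 2026-08-31).  Def-free;
tree files only.  **No stub and no summit is closed by this file; Navier–Stokes regularity is NOT proved here (rung 0).**

L0(a) of the card (`…ZShockAutonomyGlobal.minors_eq_zero_of_class_autonomy`, leafhand-1 g0) globalises the stub's LOCAL autonomy clause
(`∂_z v_b = g(t, v₂)·∂_b v₂` on an open `W₁ ∋ z₀`) IN SPACE: on the slice `t₀ = z₀.1` the autonomy minors
`M_b = ((∂_b v₂·∇(∂_z v_b) − ∂_z v_b·∇(∂_b v₂)) ∧ ∇v₂)` vanish identically.  Here the same clause is globalised IN SPACE–TIME, using the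
joint real-analyticity of the class on the open backward slab (`…Ancient.analyticOnNhd_uncurry`):
* `analyticOnNhd_uncurry_minor` — for fixed `b, p, q` the minor `(t, x) ↦ M_b(t; x, p, q)` is jointly real-analytic on `(−∞,0) × ℝ³`
  (entries `…K2OfLrcSlope.analyticOnNhd_uncurry_fderiv_entry`, second derivatives by `…AnalyticPropagation.analyticOnNhd_uncurry_fderiv_slice_apply`);
* ★ `minors_eq_zero_on_slab_of_class_autonomy` — class binders (Type-I rate, continuity, Oseen identity) + the local autonomy clause on an
  open `W₁` of the slab ⟹ `M_b(t; x, p, q) = 0` for EVERY `t < 0`, every `x, p, q`, `b = 0, 1` (the minors vanish on the open set `W₁` by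
  L0(a) applied at each of its points, hence on the connected slab by the identity theorem);
* ★ `autonomy_near_of_class_autonomy_slab` — consequently (wedge law on every slice, `…ZShockThInstantSlope.wedge_slice_of_class`, and the
  class-free L0(b) `…ZShockAutonomyPropagation.slope_both_of_wedge_near`) at EVERY time `t < 0` and EVERY point `x` with `∇ₕv₂(t,x) ≠ 0`
  the stub's clause holds afresh on that slice: `∂_z v_b = g_{t,x}(v₂)·∂_b v₂` near `x`, `b = 0, 1`.
So «autonomous at one window point» and «modulated» are GLOBAL alternatives for a class profile: the hypothesis of the residue stub
`stub_zShockThickMod` (no `(t,w)`-slope function on any sub-window through `z₀`) can only hold if NO point of the whole slab carries a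
space–time autonomy clause, and an R3 prover for `stub_zShockThickAut` may work on ANY slice `t < 0` (every slice is slice-wise autonomous
off `{∇ₕv₂ = 0}`), not only on the densely hyperbolic one — what is special about `t₀` is only `E(t₀,·) ≤ 0`.
HONEST LABEL: structure theorem (L0 in space–time); closes no stub. [folklore]
-/

noncomputable section

namespace Summit.NavierStokesRegularity.NavierStokesRegularity.Theorems.PoloidalWindowDoorPoloidalWindowRigidityZShockAutonomySlab

-- the problem directory repeats the summit name (`NavierStokesRegularity/NavierStokesRegularity`)
set_option linter.dupNamespace false

open Set Filter Topology Function
open scoped RealInnerProductSpace InnerProductSpace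
open Literature.Analysis Literature.Analysis.FluidPDE
open Summit.NavierStokesRegularity.NavierStokesRegularity.Theorems.LocalSineTubeDoorProfileAlignedWindowRigidityAncient
open Summit.NavierStokesRegularity.NavierStokesRegularity.Theorems.TubeAlternative.AnalyticPropagation
open Summit.NavierStokesRegularity.NavierStokesRegularity.Theorems.PoloidalWindowDoorPoloidalWindowRigidityK2OfLrcSlope
open Summit.NavierStokesRegularity.NavierStokesRegularity.Theorems.PoloidalWindowDoorPoloidalWindowRigidityZShockAutonomyGlobal
open Summit.NavierStokesRegularity.NavierStokesRegularity.Theorems.PoloidalWindowDoorPoloidalWindowRigidityZShockAutonomyPropagation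
open Summit.NavierStokesRegularity.NavierStokesRegularity.Theorems.PoloidalWindowDoorPoloidalWindowRigidityZShockThInstantSlope

variable {C : ℝ} {v : ℝ → EuclideanSpace ℝ (Fin 3) → EuclideanSpace ℝ (Fin 3)}

/-- **The autonomy minors are jointly real-analytic on the slab.**  For a class profile (Type-I rate, continuity on the slab, Oseen
identity) and fixed `b : Fin 3`, `p q : ℝ³`, the minor `(t,x) ↦ M_b(t; x, p, q)` is real-analytic on `(−∞, 0) × ℝ³`. [folklore] -/
theorem analyticOnNhd_uncurry_minor (hrate : HasTypeITimeDecay C v)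
    (hcont : ContinuousOn (uncurry v) (Iio (0 : ℝ) ×ˢ univ))
    (hmild : ∀ s t : ℝ, s < t → t < 0 → ∀ x,
      v t x = UnboundedOperators.heatExtension (v s) (t - s) x - oseenDuhamel 1 s v v t x)
    (b : Fin 3) (p q : EuclideanSpace ℝ (Fin 3)) :
    AnalyticOnNhd ℝ (fun z : ℝ × EuclideanSpace ℝ (Fin 3) =>
      (fderiv ℝ (v z.1) z.2 (EuclideanSpace.single b 1) 2 *
            fderiv ℝ (fun y => fderiv ℝ (v z.1) y (EuclideanSpace.single 2 1) b) z.2 p -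
          fderiv ℝ (v z.1) z.2 (EuclideanSpace.single 2 1) b *
            fderiv ℝ (fun y => fderiv ℝ (v z.1) y (EuclideanSpace.single b 1) 2) z.2 p) *
          fderiv ℝ (fun y => v z.1 y 2) z.2 q -
        (fderiv ℝ (v z.1) z.2 (EuclideanSpace.single b 1) 2 *
            fderiv ℝ (fun y => fderiv ℝ (v z.1) y (EuclideanSpace.single 2 1) b) z.2 q -
          fderiv ℝ (v z.1) z.2 (EuclideanSpace.single 2 1) b *
            fderiv ℝ (fun y => fderiv ℝ (v z.1) y (EuclideanSpace.single b 1) 2) z.2 q) *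
          fderiv ℝ (fun y => v z.1 y 2) z.2 p) (Iio (0 : ℝ) ×ˢ univ) := by
  have hanV : AnalyticOnNhd ℝ (uncurry v) (Iio (0 : ℝ) ×ˢ univ) :=
    analyticOnNhd_uncurry hcont (bdd_of_hasTypeITimeDecay hrate) hmild
  -- first-derivative entries
  have hD : AnalyticOnNhd ℝ (fun z : ℝ × EuclideanSpace ℝ (Fin 3) => fderiv ℝ (v z.1) z.2 (EuclideanSpace.single b 1) 2)
      (Iio (0 : ℝ) ×ˢ univ) := analyticOnNhd_uncurry_fderiv_entry hrate hcont hmild b 2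
  have hA : AnalyticOnNhd ℝ (fun z : ℝ × EuclideanSpace ℝ (Fin 3) => fderiv ℝ (v z.1) z.2 (EuclideanSpace.single 2 1) b)
      (Iio (0 : ℝ) ×ˢ univ) := analyticOnNhd_uncurry_fderiv_entry hrate hcont hmild 2 b
  -- second derivatives of the entries in a fixed direction
  have hA2 : ∀ r : EuclideanSpace ℝ (Fin 3), AnalyticOnNhd ℝ (fun z : ℝ × EuclideanSpace ℝ (Fin 3) =>
      fderiv ℝ (fun y => fderiv ℝ (v z.1) y (EuclideanSpace.single 2 1) b) z.2 r) (Iio (0 : ℝ) ×ˢ univ) := fun r =>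
    analyticOnNhd_uncurry_fderiv_slice_apply (w := fun s y => fderiv ℝ (v s) y (EuclideanSpace.single 2 1) b) hA isOpen_Iio
      (v := fun _ _ => r) analyticOnNhd_const
  have hD2 : ∀ r : EuclideanSpace ℝ (Fin 3), AnalyticOnNhd ℝ (fun z : ℝ × EuclideanSpace ℝ (Fin 3) =>
      fderiv ℝ (fun y => fderiv ℝ (v z.1) y (EuclideanSpace.single b 1) 2) z.2 r) (Iio (0 : ℝ) ×ˢ univ) := fun r =>
    analyticOnNhd_uncurry_fderiv_slice_apply (w := fun s y => fderiv ℝ (v s) y (EuclideanSpace.single b 1) 2) hD isOpen_Iio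
      (v := fun _ _ => r) analyticOnNhd_const
  -- the vertical component and its derivative in a fixed direction
  have hW : AnalyticOnNhd ℝ (uncurry fun s y => v s y 2) (Iio (0 : ℝ) ×ˢ univ) := by
    have e : (uncurry fun s y => v s y 2) =
        (EuclideanSpace.proj (2 : Fin 3) : EuclideanSpace ℝ (Fin 3) →L[ℝ] ℝ) ∘ uncurry v := by
      funext z; rfl
    rw [e]
    exact (EuclideanSpace.proj (2 : Fin 3)).comp_analyticOnNhd hanV
  have hW1 : ∀ r : EuclideanSpace ℝ (Fin 3), AnalyticOnNhd ℝ (fun z : ℝ × EuclideanSpace ℝ (Fin 3) =>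
      fderiv ℝ (fun y => v z.1 y 2) z.2 r) (Iio (0 : ℝ) ×ˢ univ) := fun r =>
    analyticOnNhd_uncurry_fderiv_slice_apply (w := fun s y => v s y 2) hW isOpen_Iio (v := fun _ _ => r) analyticOnNhd_const
  exact (((hD.mul (hA2 p)).sub (hA.mul (hD2 p))).mul (hW1 q)).sub (((hD.mul (hA2 q)).sub (hA.mul (hD2 q))).mul (hW1 p))

/-- ★ **L0 in space–time.**  Class binders of `stub_zShockThickAut` (Type-I rate, continuity on the slab, unit-viscosity Oseen identity)
and the stub's LOCAL autonomy clause on an open `W₁` of the backward slab (`∂_z v_b = g(t, v₂)·∂_b v₂` on `W₁`, `b ≠ 2`, SOME `g`) ⟹ the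
autonomy minors vanish on the WHOLE slab: for every `t < 0`, every `b ≠ 2` and all `x, p, q`,
`M_b(t; x, p, q) = 0`. [folklore] -/
theorem minors_eq_zero_on_slab_of_class_autonomy (C : ℝ) (v : ℝ → EuclideanSpace ℝ (Fin 3) → EuclideanSpace ℝ (Fin 3))
    (hrate : Literature.Analysis.FluidPDE.HasTypeITimeDecay C v)
    (hcont : ContinuousOn (Function.uncurry v) (Set.Iio (0 : ℝ) ×ˢ Set.univ))
    (hmild : ∀ s t : ℝ, s < t → t < 0 → ∀ x, v t x =
      Literature.Analysis.UnboundedOperators.heatExtension (v s) (t - s) x -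
        Literature.Analysis.FluidPDE.oseenDuhamel 1 s v v t x)
    {W₁ : Set (ℝ × EuclideanSpace ℝ (Fin 3))} (hW₁ : IsOpen W₁) (hW₁s : W₁ ⊆ Set.Iio (0 : ℝ) ×ˢ Set.univ)
    (hW₁ne : W₁.Nonempty) {g : ℝ → ℝ → ℝ}
    (haut : ∀ z ∈ W₁, ∀ b : Fin 3, b ≠ 2 →
      fderiv ℝ (v z.1) z.2 (EuclideanSpace.single 2 1) b =
        g z.1 (v z.1 z.2 2) * fderiv ℝ (v z.1) z.2 (EuclideanSpace.single b 1) 2)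
    {t : ℝ} (ht : t < 0) {b : Fin 3} (hb : b ≠ 2) (x p q : EuclideanSpace ℝ (Fin 3)) :
    (fderiv ℝ (v t) x (EuclideanSpace.single b 1) 2 *
          fderiv ℝ (fun y => fderiv ℝ (v t) y (EuclideanSpace.single 2 1) b) x p -
        fderiv ℝ (v t) x (EuclideanSpace.single 2 1) b *
          fderiv ℝ (fun y => fderiv ℝ (v t) y (EuclideanSpace.single b 1) 2) x p) *
        fderiv ℝ (fun y => v t y 2) x q -
      (fderiv ℝ (v t) x (EuclideanSpace.single b 1) 2 *
          fderiv ℝ (fun y => fderiv ℝ (v t) y (EuclideanSpace.single 2 1) b) x q -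
        fderiv ℝ (v t) x (EuclideanSpace.single 2 1) b *
          fderiv ℝ (fun y => fderiv ℝ (v t) y (EuclideanSpace.single b 1) 2) x q) *
        fderiv ℝ (fun y => v t y 2) x p = 0 := by
  obtain ⟨z₀, hz₀⟩ := hW₁ne
  have hM := analyticOnNhd_uncurry_minor hrate hcont hmild b p q
  -- the minor vanishes on the open set `W₁` (L0(a) at each of its points), hence near `z₀`
  have hMz : (fun z : ℝ × EuclideanSpace ℝ (Fin 3) =>
      (fderiv ℝ (v z.1) z.2 (EuclideanSpace.single b 1) 2 *
            fderiv ℝ (fun y => fderiv ℝ (v z.1) y (EuclideanSpace.single 2 1) b) z.2 p -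
          fderiv ℝ (v z.1) z.2 (EuclideanSpace.single 2 1) b *
            fderiv ℝ (fun y => fderiv ℝ (v z.1) y (EuclideanSpace.single b 1) 2) z.2 p) *
          fderiv ℝ (fun y => v z.1 y 2) z.2 q -
        (fderiv ℝ (v z.1) z.2 (EuclideanSpace.single b 1) 2 *
            fderiv ℝ (fun y => fderiv ℝ (v z.1) y (EuclideanSpace.single 2 1) b) z.2 q -
          fderiv ℝ (v z.1) z.2 (EuclideanSpace.single 2 1) b *
            fderiv ℝ (fun y => fderiv ℝ (v z.1) y (EuclideanSpace.single b 1) 2) z.2 q) *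
          fderiv ℝ (fun y => v z.1 y 2) z.2 p) =ᶠ[𝓝 z₀] 0 := by
    filter_upwards [hW₁.mem_nhds hz₀] with z hz
    exact minors_eq_zero_of_class_autonomy C v hrate hcont hmild hW₁ hW₁s hz haut hb z.2 p q
  have hpre : IsPreconnected (Set.Iio (0 : ℝ) ×ˢ (Set.univ : Set (EuclideanSpace ℝ (Fin 3)))) :=
    isPreconnected_Iio.prod isPreconnected_univ
  have h := hM.eqOn_zero_of_preconnected_of_eventuallyEq_zero hpre (hW₁s hz₀) hMz
    (Set.mk_mem_prod ht (Set.mem_univ x))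
  simpa using h

/-- ★ **Every slice of an autonomous-window class profile is slice-wise autonomous off `{∇ₕv₂ = 0}`.**  Class binders of the stubs
(Type-I rate, continuity, Oseen identity, divergence-free, poloidal) and the LOCAL autonomy clause on an open nonempty `W₁` of the slab
⟹ at EVERY time `t < 0` and EVERY point `x` with `∇ₕv₂(t,x) ≠ 0` there are an open `U ∋ x` and `gₓ : ℝ → ℝ` with
`∂_z v_b(t,·) = gₓ(v₂(t,·))·∂_b v₂(t,·)` on `U`, `b ≠ 2` (minors on the slab + wedge law on every slice + L0(b)). [folklore] -/
theorem autonomy_near_of_class_autonomy_slab (C : ℝ) (v : ℝ → EuclideanSpace ℝ (Fin 3) → EuclideanSpace ℝ (Fin 3))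
    (hrate : Literature.Analysis.FluidPDE.HasTypeITimeDecay C v)
    (hcont : ContinuousOn (Function.uncurry v) (Set.Iio (0 : ℝ) ×ˢ Set.univ))
    (hmild : ∀ s t : ℝ, s < t → t < 0 → ∀ x, v t x =
      Literature.Analysis.UnboundedOperators.heatExtension (v s) (t - s) x -
        Literature.Analysis.FluidPDE.oseenDuhamel 1 s v v t x)
    (hdiv : ∀ t < 0, Literature.Analysis.FluidPDE.VectorCalculus.IsDivFree (v t))
    (hpol : ∀ s < 0, ∀ y, ⟪Literature.Analysis.FluidPDE.curl (v s) y, EuclideanSpace.single 2 1⟫_ℝ = 0)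
    {W₁ : Set (ℝ × EuclideanSpace ℝ (Fin 3))} (hW₁ : IsOpen W₁) (hW₁s : W₁ ⊆ Set.Iio (0 : ℝ) ×ˢ Set.univ)
    (hW₁ne : W₁.Nonempty) {g : ℝ → ℝ → ℝ}
    (haut : ∀ z ∈ W₁, ∀ b : Fin 3, b ≠ 2 →
      fderiv ℝ (v z.1) z.2 (EuclideanSpace.single 2 1) b =
        g z.1 (v z.1 z.2 2) * fderiv ℝ (v z.1) z.2 (EuclideanSpace.single b 1) 2)
    {t : ℝ} (ht : t < 0) {x : EuclideanSpace ℝ (Fin 3)}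
    (hx : fderiv ℝ (v t) x (EuclideanSpace.single 0 1) 2 ≠ 0 ∨ fderiv ℝ (v t) x (EuclideanSpace.single 1 1) 2 ≠ 0) :
    ∃ gx : ℝ → ℝ, ∃ U : Set (EuclideanSpace ℝ (Fin 3)), IsOpen U ∧ x ∈ U ∧
      ∀ x' ∈ U, ∀ b : Fin 3, b ≠ 2 → fderiv ℝ (v t) x' (EuclideanSpace.single 2 1) b =
        gx (v t x' 2) * fderiv ℝ (v t) x' (EuclideanSpace.single b 1) 2 := by
  have han : AnalyticOnNhd ℝ (v t) univ := analyticOnNhd_slice hcont (bdd_of_hasTypeITimeDecay hrate) hmild ht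
  exact slope_both_of_wedge_near han (wedge_slice_of_class hrate hcont hmild hdiv hpol ht)
    (fun b hb y u u' => minors_eq_zero_on_slab_of_class_autonomy C v hrate hcont hmild hW₁ hW₁s hW₁ne haut ht hb y u u') hx


/-! ## Appended (same hand): the minors predicate itself is a GLOBAL alternative on the slab -/

/-- **An autonomy minor that vanishes on an open subset of the slab vanishes on the whole slab** (no slope clause needed: joint analyticity
of the minor + identity theorem on the connected slab).  Hence the planner-facing re-cut of `…ZShockMinorsSplit` is GLOBAL: for a class
profile either every minor `M_b(·; p, q)` vanishes on all of `(−∞,0) × ℝ³`, or each non-vanishing one is non-zero on an open DENSE subset of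
the slab — «AutM at one densely hyperbolic slice» versus «ModM» does not depend on the slice or the window point. [folklore] -/
theorem minor_eq_zero_on_slab_of_eventuallyEq (hrate : HasTypeITimeDecay C v)
    (hcont : ContinuousOn (uncurry v) (Iio (0 : ℝ) ×ˢ univ))
    (hmild : ∀ s t : ℝ, s < t → t < 0 → ∀ x,
      v t x = UnboundedOperators.heatExtension (v s) (t - s) x - oseenDuhamel 1 s v v t x)
    (b : Fin 3) (p q : EuclideanSpace ℝ (Fin 3)) {z₀ : ℝ × EuclideanSpace ℝ (Fin 3)} (hz₀ : z₀.1 < 0)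
    (hzero : (fun z : ℝ × EuclideanSpace ℝ (Fin 3) =>
      (fderiv ℝ (v z.1) z.2 (EuclideanSpace.single b 1) 2 *
            fderiv ℝ (fun y => fderiv ℝ (v z.1) y (EuclideanSpace.single 2 1) b) z.2 p -
          fderiv ℝ (v z.1) z.2 (EuclideanSpace.single 2 1) b *
            fderiv ℝ (fun y => fderiv ℝ (v z.1) y (EuclideanSpace.single b 1) 2) z.2 p) *
          fderiv ℝ (fun y => v z.1 y 2) z.2 q -
        (fderiv ℝ (v z.1) z.2 (EuclideanSpace.single b 1) 2 *
            fderiv ℝ (fun y => fderiv ℝ (v z.1) y (EuclideanSpace.single 2 1) b) z.2 q -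
          fderiv ℝ (v z.1) z.2 (EuclideanSpace.single 2 1) b *
            fderiv ℝ (fun y => fderiv ℝ (v z.1) y (EuclideanSpace.single b 1) 2) z.2 q) *
          fderiv ℝ (fun y => v z.1 y 2) z.2 p) =ᶠ[𝓝 z₀] 0)
    {t : ℝ} (ht : t < 0) (x : EuclideanSpace ℝ (Fin 3)) :
    (fderiv ℝ (v t) x (EuclideanSpace.single b 1) 2 *
          fderiv ℝ (fun y => fderiv ℝ (v t) y (EuclideanSpace.single 2 1) b) x p -
        fderiv ℝ (v t) x (EuclideanSpace.single 2 1) b *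
          fderiv ℝ (fun y => fderiv ℝ (v t) y (EuclideanSpace.single b 1) 2) x p) *
        fderiv ℝ (fun y => v t y 2) x q -
      (fderiv ℝ (v t) x (EuclideanSpace.single b 1) 2 *
          fderiv ℝ (fun y => fderiv ℝ (v t) y (EuclideanSpace.single 2 1) b) x q -
        fderiv ℝ (v t) x (EuclideanSpace.single 2 1) b *
          fderiv ℝ (fun y => fderiv ℝ (v t) y (EuclideanSpace.single b 1) 2) x q) *
        fderiv ℝ (fun y => v t y 2) x p = 0 := by
  have hM := analyticOnNhd_uncurry_minor hrate hcont hmild b p q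
  have hpre : IsPreconnected (Set.Iio (0 : ℝ) ×ˢ (Set.univ : Set (EuclideanSpace ℝ (Fin 3)))) :=
    isPreconnected_Iio.prod isPreconnected_univ
  have h := hM.eqOn_zero_of_preconnected_of_eventuallyEq_zero hpre (Set.mk_mem_prod hz₀ (Set.mem_univ z₀.2)) hzero
    (Set.mk_mem_prod ht (Set.mem_univ x))
  simpa using h

/-- **Dichotomy for one minor on the slab**: it is identically zero on `(−∞,0) × ℝ³`, or its non-vanishing set is open and DENSE in the slab
(its zero set has empty interior relative to the slab). [folklore] -/
theorem minor_zero_or_dense_ne (hrate : HasTypeITimeDecay C v)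
    (hcont : ContinuousOn (uncurry v) (Iio (0 : ℝ) ×ˢ univ))
    (hmild : ∀ s t : ℝ, s < t → t < 0 → ∀ x,
      v t x = UnboundedOperators.heatExtension (v s) (t - s) x - oseenDuhamel 1 s v v t x)
    (b : Fin 3) (p q : EuclideanSpace ℝ (Fin 3)) :
    (∀ t < 0, ∀ x : EuclideanSpace ℝ (Fin 3),
      (fderiv ℝ (v t) x (EuclideanSpace.single b 1) 2 *
            fderiv ℝ (fun y => fderiv ℝ (v t) y (EuclideanSpace.single 2 1) b) x p -
          fderiv ℝ (v t) x (EuclideanSpace.single 2 1) b *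
            fderiv ℝ (fun y => fderiv ℝ (v t) y (EuclideanSpace.single b 1) 2) x p) *
          fderiv ℝ (fun y => v t y 2) x q -
        (fderiv ℝ (v t) x (EuclideanSpace.single b 1) 2 *
            fderiv ℝ (fun y => fderiv ℝ (v t) y (EuclideanSpace.single 2 1) b) x q -
          fderiv ℝ (v t) x (EuclideanSpace.single 2 1) b *
            fderiv ℝ (fun y => fderiv ℝ (v t) y (EuclideanSpace.single b 1) 2) x q) *
          fderiv ℝ (fun y => v t y 2) x p = 0) ∨
    (∀ W' : Set (ℝ × EuclideanSpace ℝ (Fin 3)), IsOpen W' → W'.Nonempty → W' ⊆ Set.Iio (0 : ℝ) ×ˢ Set.univ →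
      ∃ z ∈ W',
        (fderiv ℝ (v z.1) z.2 (EuclideanSpace.single b 1) 2 *
              fderiv ℝ (fun y => fderiv ℝ (v z.1) y (EuclideanSpace.single 2 1) b) z.2 p -
            fderiv ℝ (v z.1) z.2 (EuclideanSpace.single 2 1) b *
              fderiv ℝ (fun y => fderiv ℝ (v z.1) y (EuclideanSpace.single b 1) 2) z.2 p) *
            fderiv ℝ (fun y => v z.1 y 2) z.2 q -
          (fderiv ℝ (v z.1) z.2 (EuclideanSpace.single b 1) 2 *
              fderiv ℝ (fun y => fderiv ℝ (v z.1) y (EuclideanSpace.single 2 1) b) z.2 q -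
            fderiv ℝ (v z.1) z.2 (EuclideanSpace.single 2 1) b *
              fderiv ℝ (fun y => fderiv ℝ (v z.1) y (EuclideanSpace.single b 1) 2) z.2 q) *
            fderiv ℝ (fun y => v z.1 y 2) z.2 p ≠ 0) := by
  by_cases h : ∀ W' : Set (ℝ × EuclideanSpace ℝ (Fin 3)), IsOpen W' → W'.Nonempty → W' ⊆ Set.Iio (0 : ℝ) ×ˢ Set.univ →
      ∃ z ∈ W',
        (fderiv ℝ (v z.1) z.2 (EuclideanSpace.single b 1) 2 *
              fderiv ℝ (fun y => fderiv ℝ (v z.1) y (EuclideanSpace.single 2 1) b) z.2 p -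
            fderiv ℝ (v z.1) z.2 (EuclideanSpace.single 2 1) b *
              fderiv ℝ (fun y => fderiv ℝ (v z.1) y (EuclideanSpace.single b 1) 2) z.2 p) *
            fderiv ℝ (fun y => v z.1 y 2) z.2 q -
          (fderiv ℝ (v z.1) z.2 (EuclideanSpace.single b 1) 2 *
              fderiv ℝ (fun y => fderiv ℝ (v z.1) y (EuclideanSpace.single 2 1) b) z.2 q -
            fderiv ℝ (v z.1) z.2 (EuclideanSpace.single 2 1) b *
              fderiv ℝ (fun y => fderiv ℝ (v z.1) y (EuclideanSpace.single b 1) 2) z.2 q) *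
            fderiv ℝ (fun y => v z.1 y 2) z.2 p ≠ 0
  · exact Or.inr h
  · left
    push Not at h
    obtain ⟨W', hW', hW'ne, hW's, hW'zero⟩ := h
    obtain ⟨z₀, hz₀⟩ := hW'ne
    have hzero : (fun z : ℝ × EuclideanSpace ℝ (Fin 3) =>
        (fderiv ℝ (v z.1) z.2 (EuclideanSpace.single b 1) 2 *
              fderiv ℝ (fun y => fderiv ℝ (v z.1) y (EuclideanSpace.single 2 1) b) z.2 p -
            fderiv ℝ (v z.1) z.2 (EuclideanSpace.single 2 1) b *
              fderiv ℝ (fun y => fderiv ℝ (v z.1) y (EuclideanSpace.single b 1) 2) z.2 p) *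
            fderiv ℝ (fun y => v z.1 y 2) z.2 q -
          (fderiv ℝ (v z.1) z.2 (EuclideanSpace.single b 1) 2 *
              fderiv ℝ (fun y => fderiv ℝ (v z.1) y (EuclideanSpace.single 2 1) b) z.2 q -
            fderiv ℝ (v z.1) z.2 (EuclideanSpace.single 2 1) b *
              fderiv ℝ (fun y => fderiv ℝ (v z.1) y (EuclideanSpace.single b 1) 2) z.2 q) *
            fderiv ℝ (fun y => v z.1 y 2) z.2 p) =ᶠ[𝓝 z₀] 0 := by
      filter_upwards [hW'.mem_nhds hz₀] with z hz
      exact hW'zero z hz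
    intro t ht x
    exact minor_eq_zero_on_slab_of_eventuallyEq hrate hcont hmild b p q (Set.mem_prod.1 (hW's hz₀)).1 hzero ht x

end Summit.NavierStokesRegularity.NavierStokesRegularity.Theorems.PoloidalWindowDoorPoloidalWindowRigidityZShockAutonomySlab
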